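/-
Origin: expansion seat `planner-pub-hodgecm-mc-axioms-1-g14-0`, handover #W188 2026-08-20T15:53:55Z md5 a3e0c082876e (PKG d7844eed2ba2 → a3e0c082876e; 273 l.; MECHANICAL (iib-R) rewrite v3.1 of the PKG file as it stands (46 token edits; rules R1x3+RX[h₂']x43)) (`HOME/mc/pub-hodgecm-mc-axioms-1-g14/revendor/kit-r55/stage55/HodgeCM/Model/Sanity/CommonReflexDegenerate.lean`, md5 a3e0c082876e, 273 lines);
landed by the gen-22 packager (p-g22) in gate run 55 REPLACES the earlier landed copy of `HodgeCM/Model/Sanity/CommonReflexDegenerate.lean` (seat copy carried the packager Origin header of an earlier run (stripped)).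
-/
/-
Origin: SANITY lane `planner-pub-hodgecm-mc-sanity-1-g11-0` (unit pub-hodgecm-mc-sanity-1-g11, gen 11 of mc-sanity-1,
node SAN-22), 2026-08-20.  NEW additive KERNEL leaf `HodgeCM/Model/Sanity/CommonReflexDegenerate.lean` over the
RUN-38 rows `HodgeCM.Model.HsmallOfCommonReflex` (mc-axioms-1 #363: the DATA record `CommonReflexInput K Ψ σ` and the
junction `hsmall_of_commonReflexInput` re-sourcing E's row 9 `hsmall` to a per-level common-reflex factorisation `hΘ`
of the theta classes) and `HodgeCM.Model.Sanity.DegenerateClosureR19AE` (SAN-21: the degenerate closure of the E TERM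
OF RECORD `Model.perL_picardCM_r19AE`; brings SAN-20 `hsmall_degS`, SAN-15 `CdegS` / `NoGoodSextic`, SAN-10b, SAN-11,
SAN-12, SAN-17a and SAN-11's `theta_thetaModelOf_degS_eq`).  Imported by nothing.  INSTALL AFTER both.
KERNEL: 0 records, 0 `Prop` definitions, 0 hypotheses minted, nothing cited, no instances; ONE `def` (a term of the
RUN-38 record type `CommonReflexInput`, built from the universe parameter (iii) `CMAbelianVarietyRealised` alone).
Expected `#print axioms`: ⊆ {propext, Classical.choice, Quot.sound}.
-/
import Summits.HodgeConjecture.HodgeCM.Model.HsmallOfCommonReflex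
import Summits.HodgeConjecture.HodgeCM.Model.Sanity.DegenerateClosureR19AE

/-!
# SAN-22 — the common-reflex re-sourcing of row 9 (`hsmall ⇐ hΘ`) over the DEGENERATE data

MODEL-CONSTRUCTION sub-cell, SANITY lane (unit `pub-hodgecm-mc-sanity-1-g11`, node SAN-22).  KERNEL only; census leaf.

RUN 38 installed mc-axioms-1's junction `Model.hsmall_of_commonReflexInput` (#363): E's row-9 binder `hsmall`
(«for every good seesaw context with `[K:ℚ] = 6` and every `i` there is a level `Γ₀` such that for all `Γ ≤ Γ₀` the
theta classes `Θ_i(Γ)` lie in `U_iso(Γ; M, Ψ_i^M, σ')` for SOME CM extension `(M, k, σ')` of the corner») follows —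
granted Riemann's fullness `hR` — from the hypothesis

  `hΘ`: «… for all `Γ ≤ Γ₀` there is a common-reflex datum `D : CommonReflexInput c.K (c.Ψ i) c.σ` with
        `Θ_i(Γ) ⊆ span_ℂ (D.surfaceClasses Γ)`»,

and RUN 39 tables glue-1's S/W-parametric corollary `Model.hLiu_of_commonReflexInput` (the same `hΘ`, instantiated
at E's model `thetaModelOf … S …`, feeding `hLiu_of_smallLevel`).  `CommonReflexInput K Ψ σ` is a DATA record
(a `Type`, asserted by no one).  This file instantiates the re-sourced row on the degenerate inhabitants `S := degS`,
`W := zeroSK ∘ W` of the earlier census (SAN-10 … SAN-21) and records what it costs there: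

* `selfCommonReflexInput` — for EVERY corner `(K, Ψ, σ)` the record type `CommonReflexInput K Ψ σ` is inhabited from
  the universe parameter (iii) `CMAbelianVarietyRealised` ALONE, by the SELF datum: `M' := K`, `Φ' := Ψ`, `k₁ := id`,
  `M := K`, `k₂ := id`, `Φ_A := Ψ`, `(A, ι_A, θ_A) :=` the realisation of `(K; Ψ)` that (iii) provides (its clauses ARE
  the clauses of `IsCMTypeRealisation`), `τ := σ`.  So the EXISTENCE of `D` in `hΘ` is never the content of the row:
  all of it sits in the inclusion clause `Θ_i(Γ) ⊆ span (D.surfaceClasses Γ)`.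
* `theta_subset_span_surfaceClasses_of_collapse` / `hTheta_of_collapse` — for ANY theta model of the end-state
  universe whose theta sets at a context collapse (`Θ_i(Γ) = {0}` for all `i`, `Γ`), the inclusion clause holds for
  EVERY datum `D` at EVERY level (`0 ∈ span`), hence `hΘ` holds there (any `Γ₀`, e.g. `Level.nonempty`'s; the self
  datum) — at every context, good or not, of any degree.
* `theta_degS_subset_span_surfaceClasses` / `hTheta_degS` — in particular over `S := degS` (E's model at ANY
  parameters `h emb cover wm d12 d34`; the theta sets collapse by SAN-11 `theta_thetaModelOf_degS_eq`): the
  re-sourced row 9 `hΘ` is FREE over the degenerate data.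
* `hsmall_degS_viaCommonReflex` — the RUN-38 junction fed with `hTheta_degS` returns EXACTLY the statement of SAN-20
  `hsmall_degS` (plus the binder `hR` the junction consumes): the two sources of row 9 agree over `degS`.
* `perL_r19AE_degS_viaCommonReflex` — E R19AE (the E term of record, 15 binders) with row 9 supplied THROUGH the
  junction (`hsmall := hsmall_of_commonReflexInput … hΘ`, `hΘ := hTheta_degS`) at `S := degS`, `W := zeroSK ∘ W`
  closes `(picardCMUniverse …).PerL` from `h hA W μ hR` modulo the ONE data binder `CdegS`; the other seven Prop-row
  discharges VERBATIM those of SAN-21 `perL_r19AE_degS`.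
* `perL_r19AE_viaCommonReflex_of_noGoodSextic` — so the re-sourced E closes from toys EXACTLY modulo the vacuity
  residual `NoGoodSextic` (refuted in kernel: SAN-15b `not_noGoodSextic`), like R10 / R13 / R15A / R17A / R18A / R19AE.

READING (census, MODEL-N ±0; nothing here is a defect claim): re-sourcing row 9 from `hsmall` / `hLiu` to the
common-reflex factorisation `hΘ` (BINDER-TRIAGE: «E assumes a per-level geometric factorisation through SOME auxiliary
CM abelian variety instead of the isotypic inclusion itself») leaves the degenerate census UNCHANGED — the datum half
of `hΘ` is supplied by (iii) for every corner, the inclusion half is free over collapsed theta sets, and `C` remains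
the sole gatekeeper of E over the degenerate data.  What `hΘ` asks beyond the toys is therefore exactly what `hsmall`
asked: an HONEST (non-collapsed) theta model whose classes factor as stated.
-/

set_option autoImplicit false

noncomputable section

namespace HodgeCM
namespace Model
namespace Sanity

open HodgeCM.Universe (SideData ThetaModel AdelicThetaCore AdelicTorusCore)
open HodgeCM.PerL34 HodgeCM.PerL34.ArchC
open Literature.AlgebraicGeometry.HodgeTheory Literature.NumberTheory.Automorphic.PicardCM
open Literature.NumberTheory.Transcendental (Arapura2012_Cor_15_4_6)
open Literature.AlgebraicGeometry.ShimuraVarieties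
open Literature.AlgebraicGeometry.Motives (CMType)
open HodgeCM.Model.ThetaSpace
open HodgeCM.Model.SupplyResidual

/-! ## § 1  The record type `CommonReflexInput K Ψ σ` is inhabited for every corner, from (iii) alone -/

section Self

/-- **The SELF common-reflex datum of a corner `(K, Ψ, σ)`**: the corner is its own common reflex — `M' := K`,
`Φ' := Ψ`, `k₁ := id_K`, `M := K`, `k₂ := id_K`, `Φ_A := Ψ`, `(A, ι_A, θ_A) :=` the realisation of `(K; Ψ)` read on
`H¹` that the universe parameter (iii) `CMAbelianVarietyRealised` provides (chosen by `Exists.choose`; its defining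
clauses are verbatim those of `IsCMTypeRealisation Ψ A ι_A θ_A`), `τ := σ` (so `τ ∘ k₂ = σ ∘ k₁` by `rfl`).  A TERM of
mc-axioms-1's RUN-38 DATA record, built from (iii) and nothing else: the record type is inhabited for every corner of
every context. -/
def selfCommonReflexInput (h₃ : CMAbelianVarietyRealised) (K : CMField) (Ψ : CMType K) (σ : K →+* ℂ) :
    CommonReflexInput K Ψ σ where
  M' := K
  Φ' := Ψ
  k₁ := RingHom.id K
  mem_iff τ := by rw [RingHom.comp_id]
  M := K
  k₂ := RingHom.id K
  ΦA := Ψ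
  memA_iff τ := by rw [RingHom.comp_id]
  A := (h₃ K Ψ).choose
  ιA := (h₃ K Ψ).choose_spec.choose
  θA := (h₃ K Ψ).choose_spec.choose_spec.choose
  isRealisation := (h₃ K Ψ).choose_spec.choose_spec.choose_spec
  τ := σ
  comp_eq := rfl

/-- `CommonReflexInput K Ψ σ` is nonempty for every corner, granted (iii). -/
theorem nonempty_commonReflexInput (h₃ : CMAbelianVarietyRealised) (K : CMField) (Ψ : CMType K) (σ : K →+* ℂ) :
    Nonempty (CommonReflexInput K Ψ σ) :=
  ⟨selfCommonReflexInput h₃ K Ψ σ⟩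

/-- The self datum's auxiliary field is the corner's own field. -/
theorem selfCommonReflexInput_M (h₃ : CMAbelianVarietyRealised) (K : CMField) (Ψ : CMType K) (σ : K →+* ℂ) :
    (selfCommonReflexInput h₃ K Ψ σ).M = K := rfl

/-- The self datum's embedding `τ` is `σ` itself. -/
theorem selfCommonReflexInput_τ (h₃ : CMAbelianVarietyRealised) (K : CMField) (Ψ : CMType K) (σ : K →+* ℂ) :
    (selfCommonReflexInput h₃ K Ψ σ).τ = σ := rfl

end Self

/-! ## § 2  Collapsed theta models of the end-state universe: the inclusion clause of `hΘ` is free -/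

section Collapse

variable (hHD : exists_isReal_hodgeModel) (hI : hodgePQ_independent_of_hodgeModel)
  (h₁ : BallQuotientUniformised)  (h₃ : CMAbelianVarietyRealised)
  (R : (picardCMUniverse hHD hI h₁ h₃).ThetaModel)
  {L : CMField} {ι₁ : L →+* ℂ} (V : HermSpace3 L ι₁) (c : SeesawCtx L)
  (hT : ∀ (i : Fin 4) (Γ : Level V), R.Theta V c i Γ = {0})
include hT

/-- Over a collapsed theta model the inclusion clause `Θ_i(Γ) ⊆ span (D.surfaceClasses Γ)` of `hΘ` holds for EVERY
common-reflex datum `D` (of any corner) at EVERY level: `0 ∈ span`. -/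
theorem theta_subset_span_surfaceClasses_of_collapse (i : Fin 4) (Γ : Level V)
    {K : CMField} {Ψ : CMType K} {σ : K →+* ℂ} (D : CommonReflexInput K Ψ σ) :
    R.Theta V c i Γ ⊆ Submodule.span ℂ (D.surfaceClasses hHD hI h₁ h₃ V Γ) := by
  rw [hT]
  exact Set.singleton_subset_iff.2 (Submodule.zero_mem _)

/-- **`hΘ`-shape is FREE over a collapsed theta model** (at every context, good or not, of any degree): any level
`Γ₀` works (one exists: `Level.nonempty`, the (W1) pair), with the self datum of the corner `(c.K, c.Ψ i, c.σ)`. -/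
theorem hTheta_of_collapse (i : Fin 4) :
    ∃ Γ₀ : Level V, ∀ Γ ≤ Γ₀, ∃ D : CommonReflexInput c.K (c.Ψ i) c.σ,
      R.Theta V c i Γ ⊆ Submodule.span ℂ (D.surfaceClasses hHD hI h₁ h₃ V Γ) := by
  obtain ⟨Γ₀⟩ := Level.nonempty V
  exact ⟨Γ₀, fun Γ _ => ⟨selfCommonReflexInput h₃ c.K (c.Ψ i) c.σ,
    theta_subset_span_surfaceClasses_of_collapse hHD hI h₁ h₃ R V c hT i Γ _⟩⟩

/-- The per-level (`hLiu`-indexed) form: at EVERY level `Γ` some datum (the self datum) carries `Θ_i(Γ)`. -/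
theorem exists_theta_subset_span_surfaceClasses_of_collapse (i : Fin 4) (Γ : Level V) :
    ∃ D : CommonReflexInput c.K (c.Ψ i) c.σ,
      R.Theta V c i Γ ⊆ Submodule.span ℂ (D.surfaceClasses hHD hI h₁ h₃ V Γ) :=
  ⟨selfCommonReflexInput h₃ c.K (c.Ψ i) c.σ,
    theta_subset_span_surfaceClasses_of_collapse hHD hI h₁ h₃ R V c hT i Γ _⟩

end Collapse

/-! ## § 3  Over `S := degS`: the re-sourced row 9 `hΘ` is free, and the junction returns SAN-20's `hsmall_degS` -/

section DegS

variable (hHD : exists_isReal_hodgeModel) (hI : hodgePQ_independent_of_hodgeModel)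
  (h₁ : BallQuotientUniformised)  (h₃ : CMAbelianVarietyRealised)

/-- Over `degS` (E's model at ANY parameters `h emb cover wm d12 d34`, as in SAN-11 / SAN-20) the inclusion clause of
`hΘ` holds for EVERY datum `D` at EVERY context, index and level (SAN-11 `theta_thetaModelOf_degS_eq`: the theta
sets collapse). -/
theorem theta_degS_subset_span_surfaceClasses (h : Bool) (emb) (cover) (wm)
    (d12 d34 : ∀ {L : CMField}, SeesawCtx L → SideData L)
    {L : CMField} {ι₁ : L →+* ℂ} (V : HermSpace3 L ι₁) (c : SeesawCtx L) (i : Fin 4) (Γ : Level V)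
    {K : CMField} {Ψ : CMType K} {σ : K →+* ℂ} (D : CommonReflexInput K Ψ σ) :
    (thetaModelOf hHD hI h₁ h₃ h emb cover wm
      (thetaOf _ (thetaClassInputOf _ (fun V c => thetaSpaceInputOf hHD hI h₁ h₃ degS V c))) d12 d34).Theta
        V c i Γ ⊆ Submodule.span ℂ (D.surfaceClasses hHD hI h₁ h₃ V Γ) :=
  theta_subset_span_surfaceClasses_of_collapse hHD hI h₁ h₃ _ V c
    (theta_thetaModelOf_degS_eq hHD hI h₁ h₃ h emb cover wm d12 d34 V c) i Γ D

/-- **The re-sourced row 9 `hΘ` over `degS`: FREE** (every context, good or not, any degree; any model parameters). -/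
theorem hTheta_degS (h : Bool) (emb) (cover) (wm) (d12 d34 : ∀ {L : CMField}, SeesawCtx L → SideData L)
    {L : CMField} {ι₁ : L →+* ℂ} (V : HermSpace3 L ι₁) (c : SeesawCtx L) (i : Fin 4) :
    ∃ Γ₀ : Level V, ∀ Γ ≤ Γ₀,
      ∃ D : CommonReflexInput c.K (c.Ψ i) c.σ,
        (thetaModelOf hHD hI h₁ h₃ h emb cover wm
          (thetaOf _ (thetaClassInputOf _ (fun V c => thetaSpaceInputOf hHD hI h₁ h₃ degS V c))) d12 d34).Theta
            V c i Γ ⊆ Submodule.span ℂ (D.surfaceClasses hHD hI h₁ h₃ V Γ) :=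
  hTheta_of_collapse hHD hI h₁ h₃ _ V c
    (theta_thetaModelOf_degS_eq hHD hI h₁ h₃ h emb cover wm d12 d34 V c) i

/-- **The RUN-38 junction over `degS` returns SAN-20's `hsmall_degS`**: `hsmall_of_commonReflexInput` fed with
`hTheta_degS` proves, VERBATIM, the statement of `hsmall_degS` (modulo the extra binder `hR` the junction consumes) —
the two sources of row 9 agree over the degenerate data. -/
theorem hsmall_degS_viaCommonReflex (hR : DeligneMilne1982_Thm_6_20_full) (h : Bool) (emb) (cover) (wm)
    (d12 d34 : ∀ {L : CMField}, SeesawCtx L → SideData L)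
    {L : CMField} {ι₁ : L →+* ℂ} (V : HermSpace3 L ι₁) (c : SeesawCtx L)
    (hc : (thetaModelOf hHD hI h₁ h₃ h emb cover wm
      (thetaOf _ (thetaClassInputOf _ (fun V c => thetaSpaceInputOf hHD hI h₁ h₃ degS V c))) d12 d34).GoodCtx ι₁ c)
    (hK : Module.finrank ℚ c.K = 6) (i : Fin 4) :
    ∃ Γ₀ : Level V, ∀ Γ ≤ Γ₀,
      ∃ (M : CMField) (k : c.K →+* M) (σ' : M →+* ℂ), σ'.comp k = c.σ ∧
        (thetaModelOf hHD hI h₁ h₃ h emb cover wm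
          (thetaOf _ (thetaClassInputOf _ (fun V c => thetaSpaceInputOf hHD hI h₁ h₃ degS V c))) d12 d34).Theta
            V c i Γ ⊆ (picardCMUniverse hHD hI h₁ h₃).Uiso Γ M (HodgeCM.CMTypeOps.inflate k (c.Ψ i)) σ' :=
  hsmall_of_commonReflexInput hHD hI h₁ h₃ hR _
    (fun V c _ _ i => hTheta_degS hHD hI h₁ h₃ h emb cover wm d12 d34 V c i) V c hc hK i

end DegS

/-! ## § 4  The degenerate closure of E R19AE with row 9 supplied THROUGH the common-reflex junction -/

variable (hHD : exists_isReal_hodgeModel) (hI : hodgePQ_independent_of_hodgeModel)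
  (h₁ : BallQuotientUniformised)

/-- **E R19AE, row 9 re-sourced (`hsmall := hsmall_of_commonReflexInput … hΘ`), over the degenerate data closes
PerL modulo the single binder `C`** — `hΘ` by `hTheta_degS`; every other Prop-row discharge VERBATIM as in SAN-21
`perL_r19AE_degS` (`hT` SAN-17a, `hpd` / `hk` by the empty fibre of `C` over `degS` (SAN-10b), `gen12` / `real34` /
`hyp12` / `hyp34` SAN-12). -/
theorem perL_r19AE_degS_viaCommonReflex (h₃' : CMAbelianVarietyEigenbasisRealised) (h : Bool)
    (hA : Arapura2012_Cor_15_4_6)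
    (W : ∀ {L : CMField} {ι₁ : L →+* ℂ} (V : HermSpace3 L ι₁) (c : SeesawCtx L), WmInput V c.D)
    (μ : ∀ {L : CMField}, SeesawCtx L → Fin 4 → NumberField.InfinitePlace L → ℤ)
    (hR : DeligneMilne1982_Thm_6_20_full)
    (C : CdegS hHD hI h₁ (cmAbelianVarietyRealised_of_eigenbasis hHD hI h₃') h hA W μ) :
    (picardCMUniverse hHD hI h₁ (cmAbelianVarietyRealised_of_eigenbasis hHD hI h₃')).PerL := by
  refine perL_picardCM_r19AE hHD hI h₁ h₃' h hA (fun V c => (W V c).zeroSK) degS μ hR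
    ?_ C ?_ ?_ ?_ ?_ ?_ ?_ ?_
  · -- `hsmall` — THROUGH the RUN-38 junction: `hsmall_of_commonReflexInput` fed with the free `hTheta_degS`
    intro L ι₁ V c hc hK i
    exact hsmall_degS_viaCommonReflex hHD hI h₁ _ hR h (embOf hHD hI h₁ _) (coverOf hHD hI h₁ _ hA)
      (wmOfInput fun V c => (W V c).zeroSK) (d12Of μ) (d34Of μ) V c hc hK i
  · -- `hT`
    intro L ι₁ V c k N
    exact isThetaArchContinuous_degS V c k N
  · -- `hpd`
    intro L ι₁ V c hV hc h6 k hk N hN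
    exact ((isEmpty_C_fibre_degS hHD hI h₁ _ V c hV).false (C V c hV hc h6)).elim
  · -- `hk`
    intro L ι₁ V c hV hc h6 k hk N hN
    exact ((isEmpty_C_fibre_degS hHD hI h₁ _ V c hV).false (C V c hV hc h6)).elim
  · -- `gen12`
    intro L ι₁ V c
    exact gen12_degS' hHD hI h₁ _ h (embOf hHD hI h₁ _) (coverOf hHD hI h₁ _ hA)
      (fun V c => (W V c).zeroSK) μ V c
  · -- `real34`
    intro L ι₁ V c _ _
    exact real34_zeroSK (embOf hHD hI h₁ _) (coverOf hHD hI h₁ _ hA) W _ h (d12Of μ) (d34Of μ) V c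
  · -- `hyp12`
    intro L ι₁ V c _ _
    exact hyp12_zeroSK (embOf hHD hI h₁ _) (coverOf hHD hI h₁ _ hA) W _ h _ _ _ V c
  · -- `hyp34`
    intro L ι₁ V c _ _
    exact hyp34_zeroSK (embOf hHD hI h₁ _) (coverOf hHD hI h₁ _ hA) W _ h _ _ _ V c

/-- **The re-sourced E R19AE closes from the degenerate data EXACTLY modulo the vacuity residual `NoGoodSextic`**
(cf. SAN-21 `perL_r19AE_of_noGoodSextic`; the residual is refuted by SAN-15b `not_noGoodSextic`). -/
theorem perL_r19AE_viaCommonReflex_of_noGoodSextic (h₃' : CMAbelianVarietyEigenbasisRealised) (h : Bool)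
    (hA : Arapura2012_Cor_15_4_6)
    (W : ∀ {L : CMField} {ι₁ : L →+* ℂ} (V : HermSpace3 L ι₁) (c : SeesawCtx L), WmInput V c.D)
    (μ : ∀ {L : CMField}, SeesawCtx L → Fin 4 → NumberField.InfinitePlace L → ℤ)
    (hR : DeligneMilne1982_Thm_6_20_full)
    (hno : NoGoodSextic hHD hI h₁ (cmAbelianVarietyRealised_of_eigenbasis hHD hI h₃') h hA W μ) :
    (picardCMUniverse hHD hI h₁ (cmAbelianVarietyRealised_of_eigenbasis hHD hI h₃')).PerL :=
  perL_r19AE_degS_viaCommonReflex hHD hI h₁ h₃' h hA W μ hR fun V c hV hc h6 => (hno V c hV hc h6).elim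

end Sanity
end Model
end HodgeCM

end
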